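import Summits.AtomisticToContinuum.HydrodynamicLimit.Theorems.ImplosionDichotomyPolynomialCompressionSupFromEnergy

/-!
# `(2,2)`-products via `L⁴` on `𝕋³`: Hölder `L⁴·L⁴·L²` and `H¹(𝕋³) ⊂ L⁴(𝕋³)` in real form

Helper file for the line `log-lipschitz-budget` of the crux
`ImplosionDichotomy.PolynomialCompression` (stub `stub_logBudgetShadowing`, level `3` of the `H³`
energy method, blueprint §4 (iii)): at level `3` the pairing
`∫ (A ∂^α δρ F^α_ρ + ρ ∂^α δu · F^α_u + B ∂^α δθ F^α_θ)` contains products of TWO second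
derivatives of the difference `δV` against the level-`3` unknown `∂³ δV''`,
`∫ ω · ∂² δV · ∂² δV' · ∂³ δV''`, which cannot be bounded pointwise × sup under the `C¹` bootstrap.
They are integrated with Hölder `L⁴ · L⁴ · L²` and the Sobolev embedding `H¹(𝕋³) ⊂ L⁴(𝕋³)`
(`Literature.Analysis.FunctionSpaces.TorusSobolevL4`,
`Torus.lintegral_enorm_pow_four_le_sq_of_isSmooth`, stated there with lower Lebesgue integrals of
`‖·‖ₑ`-powers and the operator norm of `Torus.fderiv`). This file supplies the plain real forms:

* `torus_integral_abs_mul_mul_le_L4_L4_L2` — Hölder `(4,4,2)` for continuous real `f g h` on `𝕋³`: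
  `∫ |f| |g| |h| ≤ (∫ f⁴)^{1/4} (∫ g⁴)^{1/4} (∫ h²)^{1/2}` (two Cauchy–Schwarz inequalities);
* `torus_integral_pow_four_le_sobolev_one` — ONE constant `KS > 0` with
  `∫ f⁴ ≤ KS (∫ f² + Σᵢ ∫ (∂ᵢ f)²)²` for every smooth real `f` on `𝕋³`
  (`torus_integral_norm_pow_four_le_sobolev_one`: the same for `V3`-valued fields, with norms);
* `torus_l4_product_bound` — the packaged level-`3` tool: ONE constant `KS > 0` with
  `∫ |f| |g| |h| ≤ KS √(N f) √(N g) √(∫ h²)`, `N f = ∫ f² + Σᵢ ∫ (∂ᵢ f)²`, for smooth real `f g`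
  and continuous real `h`;
* `torus_l4_product_bound_weighted` — the same against the WEIGHTED `L²` quantities of the energy
  method: for a continuous multiplier `|w| ≤ M` and continuous weights `ωₖ ≥ mₖ > 0`
  (`k = 1, 2, 3`, one for each factor),
  `∫ |w| |f| |g| |h| ≤ KS M √(m₁⁻¹ N_{ω₁} f) √(m₂⁻¹ N_{ω₂} g) √(m₃⁻¹ ∫ ω₃ h²)`,
  `N_ω f = ∫ ω f² + Σᵢ ∫ ω (∂ᵢ f)²` (through `torus_integral_sq_le_of_le_weight`).

Proofs: the `ℝ≥0∞` statement of `TorusSobolevL4` is converted with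
`∫⁻ ‖g‖ₑⁿ = ofReal (∫ ‖g‖ⁿ)` for continuous `g` on the compact torus and the pointwise bound
`‖Df‖² ≤ 3 Σᵢ ‖∂ᵢ f‖²` (`Torus.norm_fderiv_sq_le_card_mul_sum`), exactly as in
`Literature.Analysis.FunctionSpaces.TorusSobolevSup`; Hölder `(4,4,2)` is Cauchy–Schwarz twice
(`∫ (|f||g|)·|h| ≤ √(∫ f²g²) √(∫ h²)`, `∫ f² g² ≤ √(∫ f⁴) √(∫ g⁴)`). Constants are existential
(Mathlib's Gagliardo–Nirenberg–Sobolev constant). All public statements are in the `∀`-form of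
their registered signatures.
-/

noncomputable section

namespace Summit.AtomisticToContinuum.HydrodynamicLimit.Theorems

open MeasureTheory
open scoped ENNReal NNReal
open Literature.MathematicalPhysics.KineticTheory Literature.Analysis.FunctionSpaces

/-! ### Conversions and Cauchy–Schwarz for continuous functions on `𝕋³` -/

/-- `∫⁻ ‖g‖ₑⁿ = ofReal (∫ ‖g‖ⁿ)` for a continuous `g` on the (compact) torus `𝕋³`. [folklore] -/
private theorem lintegral_enorm_pow_eq_ofReal {F' : Type*} [NormedAddCommGroup F'] {g : T3 → F'}
    (hg : Continuous g) (n : ℕ) :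
    ∫⁻ y, ‖g y‖ₑ ^ n = ENNReal.ofReal (∫ y, ‖g y‖ ^ n) := by
  have hi : Integrable (fun y => ‖g y‖ ^ n) volume := (hg.norm.pow n).integrable_unitAddTorus
  rw [ofReal_integral_eq_lintegral_ofReal hi (ae_of_all _ fun y => pow_nonneg (norm_nonneg _) n)]
  exact lintegral_congr fun y => by rw [← ofReal_norm, ENNReal.ofReal_pow (norm_nonneg _)]

/-- Cauchy–Schwarz for nonnegative continuous real functions on `𝕋³`, Bochner form:
`∫ f g ≤ √(∫ f²) √(∫ g²)` (Mathlib's Hölder inequality `integral_mul_le_Lp_mul_Lq_of_nonneg`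
with `p = q = 2`). [folklore] -/
private theorem integral_mul_le_sqrt_mul_sqrt {f g : T3 → ℝ} (hf : Continuous f)
    (hg : Continuous g) (hf0 : ∀ x, 0 ≤ f x) (hg0 : ∀ x, 0 ≤ g x) :
    ∫ x, f x * g x ≤ Real.sqrt (∫ x, f x ^ 2) * Real.sqrt (∫ x, g x ^ 2) := by
  have h2 : ENNReal.ofReal (2 : ℝ) = 2 := by simp
  have hfm : MemLp f 2 volume := hf.memLp_of_hasCompactSupport (HasCompactSupport.of_compactSpace f)
  have hgm : MemLp g 2 volume := hg.memLp_of_hasCompactSupport (HasCompactSupport.of_compactSpace g)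
  have hH := integral_mul_le_Lp_mul_Lq_of_nonneg (μ := volume) Real.HolderConjugate.two_two
    (ae_of_all _ hf0) (ae_of_all _ hg0) (by rw [h2]; exact hfm) (by rw [h2]; exact hgm)
  simp only [Real.rpow_two] at hH
  rwa [Real.sqrt_eq_rpow, Real.sqrt_eq_rpow]

/-! ### `H¹(𝕋³) ⊂ L⁴(𝕋³)` for smooth fields, Bochner form -/

section General

variable {F' : Type*} [NormedAddCommGroup F'] [NormedSpace ℝ F'] [FiniteDimensional ℝ F']

/-- `H¹(𝕋³) ⊂ L⁴(𝕋³)` for smooth fields with values in a finite-dimensional space, Bochner form: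
there is `K > 0` (depending only on `F'`) with `∫ ‖f‖⁴ ≤ K (∫ ‖f‖² + Σᵢ ∫ ‖∂ᵢ f‖²)²` for every
smooth `f : 𝕋³ → F'` (from `Torus.lintegral_enorm_pow_four_le_sq_of_isSmooth`, `card (Fin 3) = 3`,
and `‖Df‖² ≤ 3 Σᵢ ‖∂ᵢ f‖²`). [folklore] -/
private theorem integral_norm_pow_four_le_aux :
    ∃ K : ℝ, 0 < K ∧ ∀ f : T3 → F', Torus.IsSmooth f →
      ∫ x, ‖f x‖ ^ 4 ≤ K * ((∫ x, ‖f x‖ ^ 2) + ∑ i, ∫ x, ‖Torus.partialDeriv i f x‖ ^ 2) ^ 2 := by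
  obtain ⟨K, hK⟩ := Torus.lintegral_enorm_pow_four_le_sq_of_isSmooth (d := Fin 3) (F' := F')
    (by rw [Fintype.card_fin]) (by rw [Fintype.card_fin]; norm_num)
  have hK0 : (0 : ℝ) ≤ K := NNReal.coe_nonneg K
  refine ⟨9 * K + 1, by positivity, fun f hf => ?_⟩
  have hf1 : Torus.IsContDiff 1 f := hf.isContDiff (by simp)
  set a : ℝ := ∫ x, ‖f x‖ ^ 2 with ha
  set b : Fin 3 → ℝ := fun i => ∫ x, ‖Torus.partialDeriv i f x‖ ^ 2 with hb
  have ha0 : 0 ≤ a := integral_nonneg fun _ => by positivity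
  have hb0 : ∀ i, 0 ≤ b i := fun i => integral_nonneg fun _ => by positivity
  have hsb0 : 0 ≤ ∑ i, b i := Finset.sum_nonneg fun i _ => hb0 i
  -- the densities as `ofReal` of real integrals
  have e4 : ∫⁻ x, ‖f x‖ₑ ^ 4 = ENNReal.ofReal (∫ x, ‖f x‖ ^ 4) :=
    lintegral_enorm_pow_eq_ofReal hf.continuous 4
  have e2 : ∫⁻ x, ‖f x‖ₑ ^ 2 = ENNReal.ofReal a := lintegral_enorm_pow_eq_ofReal hf.continuous 2
  have eB : ∀ i, ∫⁻ x, ‖Torus.partialDeriv i f x‖ₑ ^ 2 = ENNReal.ofReal (b i) := fun i =>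
    lintegral_enorm_pow_eq_ofReal (hf.partialDeriv i).continuous 2
  -- `‖Df‖ₑ² ≤ 3 Σᵢ ‖∂ᵢ f‖ₑ²` pointwise, hence `∫⁻ ‖Df‖ₑ² ≤ ofReal (3 Σᵢ bᵢ)`
  have hpt : ∀ y, ‖Torus.fderiv f y‖ₑ ^ 2 ≤ 3 * ∑ i, ‖Torus.partialDeriv i f y‖ₑ ^ 2 := by
    intro y
    have h := Torus.norm_fderiv_sq_le_card_mul_sum hf1 y
    rw [Fintype.card_fin] at h
    push_cast at h
    rw [← ofReal_norm, ← ENNReal.ofReal_pow (norm_nonneg _)]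
    refine (ENNReal.ofReal_le_ofReal h).trans (le_of_eq ?_)
    rw [ENNReal.ofReal_mul (by norm_num), ENNReal.ofReal_ofNat,
      ENNReal.ofReal_sum_of_nonneg (fun i _ => sq_nonneg _)]
    congr 1
    refine Finset.sum_congr rfl fun i _ => ?_
    rw [ENNReal.ofReal_pow (norm_nonneg _), ofReal_norm]
  have hmeas : ∀ i, Measurable fun y => ‖Torus.partialDeriv i f y‖ₑ ^ 2 := fun i =>
    (hf.partialDeriv i).continuous.enorm.measurable.pow_const 2
  have hD : ∫⁻ y, ‖Torus.fderiv f y‖ₑ ^ 2 ≤ ENNReal.ofReal (3 * ∑ i, b i) := by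
    calc ∫⁻ y, ‖Torus.fderiv f y‖ₑ ^ 2
        ≤ ∫⁻ y, 3 * ∑ i, ‖Torus.partialDeriv i f y‖ₑ ^ 2 := lintegral_mono hpt
      _ = 3 * ∑ i, ∫⁻ y, ‖Torus.partialDeriv i f y‖ₑ ^ 2 := by
          rw [lintegral_const_mul _ (Finset.measurable_sum _ fun i _ => hmeas i),
            lintegral_finsetSum _ fun i _ => hmeas i]
      _ = ENNReal.ofReal (3 * ∑ i, b i) := by
          rw [ENNReal.ofReal_mul (by norm_num), ENNReal.ofReal_ofNat,
            ENNReal.ofReal_sum_of_nonneg (fun i _ => hb0 i)]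
          congr 1
          exact Finset.sum_congr rfl fun i _ => eB i
  -- the `ℝ≥0∞` estimate, converted
  have h' : ENNReal.ofReal (∫ x, ‖f x‖ ^ 4) ≤ ENNReal.ofReal (K * (a + 3 * ∑ i, b i) ^ 2) := by
    calc ENNReal.ofReal (∫ x, ‖f x‖ ^ 4) = ∫⁻ x, ‖f x‖ₑ ^ 4 := e4.symm
      _ ≤ K * ((∫⁻ x, ‖f x‖ₑ ^ 2) + ∫⁻ x, ‖Torus.fderiv f x‖ₑ ^ 2) ^ 2 := hK f hf
      _ ≤ K * (ENNReal.ofReal a + ENNReal.ofReal (3 * ∑ i, b i)) ^ 2 := by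
          rw [e2]
          gcongr
      _ = ENNReal.ofReal (K * (a + 3 * ∑ i, b i) ^ 2) := by
          rw [← ENNReal.ofReal_add ha0 (by positivity), ← ENNReal.ofReal_pow (by positivity),
            ← ENNReal.ofReal_coe_nnreal, ← ENNReal.ofReal_mul hK0]
  rw [ENNReal.ofReal_le_ofReal_iff (by positivity)] at h'
  calc ∫ x, ‖f x‖ ^ 4 ≤ K * (a + 3 * ∑ i, b i) ^ 2 := h'
    _ ≤ K * (3 * (a + ∑ i, b i)) ^ 2 := by
        gcongr
        linarith
    _ = 9 * K * (a + ∑ i, b i) ^ 2 := by ring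
    _ ≤ (9 * K + 1) * (a + ∑ i, b i) ^ 2 := by
        gcongr
        linarith

end General

/-- **`H¹(𝕋³) ⊂ L⁴(𝕋³)`, real form** (Temam 1979, Ch. II §1.1, (1.13): the embedding behind the
continuity of the trilinear form for `n ≤ 4`; Evans 2010, §5.6.1): there is ONE constant `KS > 0`
such that every smooth real `f` on `𝕋³` satisfies `∫ f⁴ ≤ KS (∫ f² + Σᵢ ∫ (∂ᵢ f)²)²`
(the case `F' = ℝ` of the Bochner form of `Torus.lintegral_enorm_pow_four_le_sq_of_isSmooth`).
[folklore] -/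
theorem torus_integral_pow_four_le_sobolev_one :
    ∃ KS : ℝ, 0 < KS ∧ ∀ {f : T3 → ℝ}, Torus.IsSmooth f →
      ∫ x, f x ^ 4 ≤ KS * ((∫ x, f x ^ 2) + ∑ i, ∫ x, Torus.partialDeriv i f x ^ 2) ^ 2 := by
  obtain ⟨K, hK, h⟩ := integral_norm_pow_four_le_aux (F' := ℝ)
  refine ⟨K, hK, fun {f} hf => ?_⟩
  have h1 := h f hf
  have e4 : ∀ x, |f x| ^ 4 = f x ^ 4 := fun x => by
    rw [← abs_pow, abs_of_nonneg (by positivity)]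
  simp only [Real.norm_eq_abs, sq_abs, e4] at h1
  exact h1

/-- **`H¹(𝕋³) ⊂ L⁴(𝕋³)`, `V3`-valued form**: there is ONE constant `KS > 0` such that every smooth
`f : 𝕋³ → V3` satisfies `∫ ‖f‖⁴ ≤ KS (∫ ‖f‖² + Σᵢ ∫ ‖∂ᵢ f‖²)²`. [folklore] -/
theorem torus_integral_norm_pow_four_le_sobolev_one :
    ∃ KS : ℝ, 0 < KS ∧ ∀ {f : T3 → V3}, Torus.IsSmooth f →
      ∫ x, ‖f x‖ ^ 4 ≤ KS * ((∫ x, ‖f x‖ ^ 2) + ∑ i, ∫ x, ‖Torus.partialDeriv i f x‖ ^ 2) ^ 2 := by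
  obtain ⟨K, hK, h⟩ := integral_norm_pow_four_le_aux (F' := V3)
  exact ⟨K, hK, fun {f} hf => h f hf⟩

/-! ### Hölder `(4,4,2)` in real form -/

/-- **Hölder `L⁴ · L⁴ · L²` on `𝕋³`, real form**: for continuous real `f g h` on `𝕋³`,
`∫ |f| |g| |h| ≤ (∫ f⁴)^{1/4} (∫ g⁴)^{1/4} (∫ h²)^{1/2}` (Cauchy–Schwarz for `(|f||g|)·|h|` and
for `f²·g²`; `𝕋³` is compact, so all integrands are integrable). [folklore] -/
theorem torus_integral_abs_mul_mul_le_L4_L4_L2 :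
    ∀ {f g h : T3 → ℝ}, Continuous f → Continuous g → Continuous h →
      ∫ x, |f x| * |g x| * |h x| ≤
        (∫ x, f x ^ 4) ^ (1 / 4 : ℝ) * (∫ x, g x ^ 4) ^ (1 / 4 : ℝ) *
          (∫ x, h x ^ 2) ^ (1 / 2 : ℝ) := by
  intro f g h hf hg hh
  have hA0 : 0 ≤ ∫ x, f x ^ 4 := integral_nonneg fun x => by positivity
  have hB0 : 0 ≤ ∫ x, g x ^ 4 := integral_nonneg fun x => by positivity
  -- first Cauchy–Schwarz: `∫ (|f||g|)·|h| ≤ √(∫ f² g²) √(∫ h²)`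
  have h1 : ∫ x, |f x| * |g x| * |h x| ≤
      Real.sqrt (∫ x, (|f x| * |g x|) ^ 2) * Real.sqrt (∫ x, |h x| ^ 2) :=
    integral_mul_le_sqrt_mul_sqrt (hf.abs.mul hg.abs) hh.abs
      (fun x => mul_nonneg (abs_nonneg _) (abs_nonneg _)) fun x => abs_nonneg _
  have eP : ∀ x, (|f x| * |g x|) ^ 2 = f x ^ 2 * g x ^ 2 := fun x => by
    rw [mul_pow, sq_abs, sq_abs]
  have eh : ∀ x, |h x| ^ 2 = h x ^ 2 := fun x => sq_abs _
  simp only [eP, eh] at h1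
  -- second Cauchy–Schwarz: `∫ f² g² ≤ √(∫ f⁴) √(∫ g⁴)`
  have h2 : ∫ x, f x ^ 2 * g x ^ 2 ≤ Real.sqrt (∫ x, f x ^ 4) * Real.sqrt (∫ x, g x ^ 4) := by
    have h := integral_mul_le_sqrt_mul_sqrt (f := fun x => f x ^ 2) (g := fun x => g x ^ 2)
      (hf.pow 2) (hg.pow 2) (fun x => sq_nonneg _) fun x => sq_nonneg _
    have e4 : ∀ t : ℝ, (t ^ 2) ^ 2 = t ^ 4 := fun t => by ring
    simpa only [e4] using h
  calc ∫ x, |f x| * |g x| * |h x|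
      ≤ Real.sqrt (∫ x, f x ^ 2 * g x ^ 2) * Real.sqrt (∫ x, h x ^ 2) := h1
    _ ≤ Real.sqrt (Real.sqrt (∫ x, f x ^ 4) * Real.sqrt (∫ x, g x ^ 4)) *
          Real.sqrt (∫ x, h x ^ 2) := by gcongr
    _ = (∫ x, f x ^ 4) ^ (1 / 4 : ℝ) * (∫ x, g x ^ 4) ^ (1 / 4 : ℝ) *
          (∫ x, h x ^ 2) ^ (1 / 2 : ℝ) := by
        rw [Real.sqrt_mul (Real.sqrt_nonneg _), Real.sqrt_eq_rpow, Real.sqrt_eq_rpow,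
          Real.sqrt_eq_rpow, Real.sqrt_eq_rpow, Real.sqrt_eq_rpow, ← Real.rpow_mul hA0,
          ← Real.rpow_mul hB0]
        norm_num

/-! ### The packaged level-`3` tool -/

/-- **`(2,2)`-products via `L⁴` on `𝕋³`.** There is ONE constant `KS > 0` such that for all
smooth real `f g` and continuous real `h` on `𝕋³`,
`∫ |f| |g| |h| ≤ KS √(∫ f² + Σᵢ ∫ (∂ᵢ f)²) √(∫ g² + Σᵢ ∫ (∂ᵢ g)²) √(∫ h²)`
(Hölder `L⁴ · L⁴ · L²` and `H¹(𝕋³) ⊂ L⁴(𝕋³)`, `torus_integral_pow_four_le_sobolev_one`; `KS` is the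
square root of the constant there). [folklore] -/
theorem torus_l4_product_bound :
    ∃ KS : ℝ, 0 < KS ∧ ∀ {f g h : T3 → ℝ}, Torus.IsSmooth f → Torus.IsSmooth g → Continuous h →
      ∫ x, |f x| * |g x| * |h x| ≤
        KS * Real.sqrt ((∫ x, f x ^ 2) + ∑ i, ∫ x, Torus.partialDeriv i f x ^ 2) *
          Real.sqrt ((∫ x, g x ^ 2) + ∑ i, ∫ x, Torus.partialDeriv i g x ^ 2) *
            Real.sqrt (∫ x, h x ^ 2) := by
  obtain ⟨K, hK, hK4⟩ := torus_integral_pow_four_le_sobolev_one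
  refine ⟨Real.sqrt K, Real.sqrt_pos.2 hK, fun {f g h} hf hg hh => ?_⟩
  set Nf : ℝ := (∫ x, f x ^ 2) + ∑ i, ∫ x, Torus.partialDeriv i f x ^ 2 with hNf
  set Ng : ℝ := (∫ x, g x ^ 2) + ∑ i, ∫ x, Torus.partialDeriv i g x ^ 2 with hNg
  have hNf0 : 0 ≤ Nf := add_nonneg (integral_nonneg fun x => sq_nonneg _)
    (Finset.sum_nonneg fun i _ => integral_nonneg fun x => sq_nonneg _)
  have hNg0 : 0 ≤ Ng := add_nonneg (integral_nonneg fun x => sq_nonneg _)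
    (Finset.sum_nonneg fun i _ => integral_nonneg fun x => sq_nonneg _)
  have hfc : Continuous f := hf.continuous
  have hgc : Continuous g := hg.continuous
  -- first Cauchy–Schwarz
  have h1 : ∫ x, |f x| * |g x| * |h x| ≤
      Real.sqrt (∫ x, (|f x| * |g x|) ^ 2) * Real.sqrt (∫ x, |h x| ^ 2) :=
    integral_mul_le_sqrt_mul_sqrt (hfc.abs.mul hgc.abs) hh.abs
      (fun x => mul_nonneg (abs_nonneg _) (abs_nonneg _)) fun x => abs_nonneg _
  have eP : ∀ x, (|f x| * |g x|) ^ 2 = f x ^ 2 * g x ^ 2 := fun x => by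
    rw [mul_pow, sq_abs, sq_abs]
  have eh : ∀ x, |h x| ^ 2 = h x ^ 2 := fun x => sq_abs _
  simp only [eP, eh] at h1
  -- second Cauchy–Schwarz and `H¹ ⊂ L⁴`: `∫ f² g² ≤ √(∫ f⁴) √(∫ g⁴) ≤ K · Nf · Ng`
  have h2 : ∫ x, f x ^ 2 * g x ^ 2 ≤ K * Nf * Ng := by
    have h := integral_mul_le_sqrt_mul_sqrt (f := fun x => f x ^ 2) (g := fun x => g x ^ 2)
      (hfc.pow 2) (hgc.pow 2) (fun x => sq_nonneg _) fun x => sq_nonneg _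
    have e4 : ∀ t : ℝ, (t ^ 2) ^ 2 = t ^ 4 := fun t => by ring
    simp only [e4] at h
    have h4f : Real.sqrt (∫ x, f x ^ 4) ≤ Real.sqrt K * Nf :=
      calc Real.sqrt (∫ x, f x ^ 4) ≤ Real.sqrt (K * Nf ^ 2) := Real.sqrt_le_sqrt (hK4 hf)
        _ = Real.sqrt K * Nf := by rw [Real.sqrt_mul hK.le, Real.sqrt_sq hNf0]
    have h4g : Real.sqrt (∫ x, g x ^ 4) ≤ Real.sqrt K * Ng :=
      calc Real.sqrt (∫ x, g x ^ 4) ≤ Real.sqrt (K * Ng ^ 2) := Real.sqrt_le_sqrt (hK4 hg)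
        _ = Real.sqrt K * Ng := by rw [Real.sqrt_mul hK.le, Real.sqrt_sq hNg0]
    calc ∫ x, f x ^ 2 * g x ^ 2 ≤ Real.sqrt (∫ x, f x ^ 4) * Real.sqrt (∫ x, g x ^ 4) := h
      _ ≤ (Real.sqrt K * Nf) * (Real.sqrt K * Ng) :=
          mul_le_mul h4f h4g (Real.sqrt_nonneg _) (by positivity)
      _ = K * Nf * Ng := by
          have : Real.sqrt K * Real.sqrt K = K := Real.mul_self_sqrt hK.le
          linear_combination Nf * Ng * this
  calc ∫ x, |f x| * |g x| * |h x|
      ≤ Real.sqrt (∫ x, f x ^ 2 * g x ^ 2) * Real.sqrt (∫ x, h x ^ 2) := h1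
    _ ≤ Real.sqrt (K * Nf * Ng) * Real.sqrt (∫ x, h x ^ 2) := by gcongr
    _ = Real.sqrt K * Real.sqrt Nf * Real.sqrt Ng * Real.sqrt (∫ x, h x ^ 2) := by
        rw [Real.sqrt_mul (by positivity) Ng, Real.sqrt_mul hK.le Nf]

/-- **`(2,2)`-products via `L⁴` on `𝕋³`, weighted form.** There is ONE constant `KS > 0` such that
for every continuous multiplier `w` with `|w| ≤ M`, all continuous weights `ω₁ ω₂ ω₃` on `𝕋³` with
`0 < mₖ ≤ ωₖ`, all smooth real `f g` and every continuous real `h`,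
`∫ |w| |f| |g| |h| ≤ KS M √(m₁⁻¹ (∫ ω₁ f² + Σᵢ ∫ ω₁ (∂ᵢ f)²)) √(m₂⁻¹ (∫ ω₂ g² + Σᵢ ∫ ω₂ (∂ᵢ g)²))
  √(m₃⁻¹ ∫ ω₃ h²)`
(`torus_l4_product_bound` and the weighted-to-plain comparison `∫ q² ≤ m⁻¹ ∫ ω q²`,
`torus_integral_sq_le_of_le_weight`, on each of the `1 + 3`, `1 + 3`, `1` plain integrals).
[folklore] -/
theorem torus_l4_product_bound_weighted :
    ∃ KS : ℝ, 0 < KS ∧ ∀ {w ω₁ ω₂ ω₃ : T3 → ℝ} {M m₁ m₂ m₃ : ℝ},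
      Continuous w → Continuous ω₁ → Continuous ω₂ → Continuous ω₃ → (∀ x, |w x| ≤ M) →
      0 < m₁ → 0 < m₂ → 0 < m₃ → (∀ x, m₁ ≤ ω₁ x) → (∀ x, m₂ ≤ ω₂ x) → (∀ x, m₃ ≤ ω₃ x) →
      ∀ {f g h : T3 → ℝ}, Torus.IsSmooth f → Torus.IsSmooth g → Continuous h →
        ∫ x, |w x| * |f x| * |g x| * |h x| ≤
          KS * M *
            Real.sqrt (m₁⁻¹ * ((∫ x, ω₁ x * f x ^ 2) +
              ∑ i, ∫ x, ω₁ x * Torus.partialDeriv i f x ^ 2)) *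
            Real.sqrt (m₂⁻¹ * ((∫ x, ω₂ x * g x ^ 2) +
              ∑ i, ∫ x, ω₂ x * Torus.partialDeriv i g x ^ 2)) *
            Real.sqrt (m₃⁻¹ * ∫ x, ω₃ x * h x ^ 2) := by
  obtain ⟨K, hK, hP⟩ := torus_l4_product_bound
  refine ⟨K, hK, ?_⟩
  intro w ω₁ ω₂ ω₃ M m₁ m₂ m₃ hw hω₁ hω₂ hω₃ hwM hm₁ hm₂ hm₃ hle₁ hle₂ hle₃ f g h hf hg hh
  have hM0 : 0 ≤ M := (abs_nonneg _).trans (hwM 0)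
  have hfc : Continuous f := hf.continuous
  have hgc : Continuous g := hg.continuous
  set Nf : ℝ := (∫ x, f x ^ 2) + ∑ i, ∫ x, Torus.partialDeriv i f x ^ 2 with hNf
  set Ng : ℝ := (∫ x, g x ^ 2) + ∑ i, ∫ x, Torus.partialDeriv i g x ^ 2 with hNg
  set H : ℝ := ∫ x, h x ^ 2 with hH
  -- plain quantities are bounded by `m⁻¹ ×` weighted ones
  have hNf : Nf ≤ m₁⁻¹ * ((∫ x, ω₁ x * f x ^ 2) + ∑ i, ∫ x, ω₁ x * Torus.partialDeriv i f x ^ 2) := by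
    rw [mul_add, Finset.mul_sum]
    exact add_le_add (torus_integral_sq_le_of_le_weight hfc hω₁ hm₁ hle₁)
      (Finset.sum_le_sum fun i _ =>
        torus_integral_sq_le_of_le_weight (hf.partialDeriv i).continuous hω₁ hm₁ hle₁)
  have hNg : Ng ≤ m₂⁻¹ * ((∫ x, ω₂ x * g x ^ 2) + ∑ i, ∫ x, ω₂ x * Torus.partialDeriv i g x ^ 2) := by
    rw [mul_add, Finset.mul_sum]
    exact add_le_add (torus_integral_sq_le_of_le_weight hgc hω₂ hm₂ hle₂)
      (Finset.sum_le_sum fun i _ =>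
        torus_integral_sq_le_of_le_weight (hg.partialDeriv i).continuous hω₂ hm₂ hle₂)
  have hHle : H ≤ m₃⁻¹ * ∫ x, ω₃ x * h x ^ 2 := torus_integral_sq_le_of_le_weight hh hω₃ hm₃ hle₃
  -- `∫ |w||f||g||h| ≤ M ∫ |f||g||h|`
  have hi1 : Integrable (fun x => |w x| * |f x| * |g x| * |h x|) volume :=
    (((hw.abs.mul hfc.abs).mul hgc.abs).mul hh.abs).integrable_unitAddTorus
  have hi2 : Integrable (fun x => |f x| * |g x| * |h x|) volume :=
    ((hfc.abs.mul hgc.abs).mul hh.abs).integrable_unitAddTorus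
  have hwle : ∫ x, |w x| * |f x| * |g x| * |h x| ≤ M * ∫ x, |f x| * |g x| * |h x| := by
    rw [← integral_const_mul]
    refine integral_mono hi1 (hi2.const_mul M) fun x => ?_
    have h0 : 0 ≤ |f x| * |g x| * |h x| := by positivity
    calc |w x| * |f x| * |g x| * |h x| = |w x| * (|f x| * |g x| * |h x|) := by ring
      _ ≤ M * (|f x| * |g x| * |h x|) := mul_le_mul_of_nonneg_right (hwM x) h0
  calc ∫ x, |w x| * |f x| * |g x| * |h x| ≤ M * ∫ x, |f x| * |g x| * |h x| := hwle
    _ ≤ M * (K * Real.sqrt Nf * Real.sqrt Ng * Real.sqrt H) :=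
        mul_le_mul_of_nonneg_left (hP hf hg hh) hM0
    _ ≤ M * (K * Real.sqrt (m₁⁻¹ * ((∫ x, ω₁ x * f x ^ 2) +
              ∑ i, ∫ x, ω₁ x * Torus.partialDeriv i f x ^ 2)) *
            Real.sqrt (m₂⁻¹ * ((∫ x, ω₂ x * g x ^ 2) +
              ∑ i, ∫ x, ω₂ x * Torus.partialDeriv i g x ^ 2)) *
            Real.sqrt (m₃⁻¹ * ∫ x, ω₃ x * h x ^ 2)) := by
        gcongr
    _ = _ := by ring

end Summit.AtomisticToContinuum.HydrodynamicLimit.Theorems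

end
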